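import Literature.Barriers.SmoothPoincare4.ExoticOpenFourSpace
import Literature.Topology.FourManifolds.LatticeFormsCharacteristic
import Literature.Topology.FourManifolds.LatticeFormsUnitBasis
import Literature.Topology.FourManifolds.SmoothIntersectionFormsRealisationDiagonal
import HarnessLib

/-!
# DeMichelis–Freedman 1992, §1: the characteristic-class arithmetic of Kotschick's
# `SO(3)`-bundle over `ℂℙ² # 8(-ℂℙ²)` (pp. 221–222)

Companion of `ExoticOpenFourSpace.lean` (the named fact
`Literature.Barriers.SmoothPoincare4.deMichelisFreedman1992_continuum` = DeMichelis–Freedman 1992,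
Thm. 4.1 + Cor. 4.1) and of the `ExoticOpenFourSpace*Proofs.lean` files, which prove every
non-gauge-theoretic step of that paper bearing on Thm. 4.1. The gauge-theoretic input of the
whole argument is Kotschick's invariant `Φ`, reviewed in §1 ("A brief review of the
`Φ`-invariant", pp. 221–222): the signed count of a compact, zero-dimensional moduli space of
anti-self-dual (ASD) connections on one particular `SO(3)`-bundle `E` over `Q = ℂℙ² # 8(-ℂℙ²)`
— and over any smooth manifold homotopy equivalent to `Q`, such as the Barlow surface `B` —
with `Φ(Q) = 0 ≠ Φ(B)`. That `Φ` is defined at all rests on three properties of `E` (no reducible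
connections, virtual dimension `0`, compactness) which §1 derives from CHARACTERISTIC-CLASS
ARITHMETIC in the lattice `H²(Q; ℤ) ≅ ⟨1⟩ ⊕ 8⟨-1⟩`. This file proves exactly that arithmetic, in
the lattice vocabulary of `Literature/Topology/FourManifolds/LatticeForms*.lean` (characteristic
vectors `LinearMap.BilinForm.IsCharacteristic`, van der Blij's lemma
`IsCharacteristic.apply_self_modEq_signature`, `b⁺`/`b⁻`/signature in an orthogonal basis), in the
style of the tree's `ninefoldBlowupForm` / `kirbyTorusClass` (Kirby 1989, Ch. V).

The printed text (DeMichelis–Freedman 1992, §1, p. 221 l. −9 to p. 222 l. 14):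

> "The canonical bundle over `ℂP²` is a `U(1) = SO(2)` bundle with Euler class `χ` the positive
> generator of `H²(ℂP², ℤ)` and `p₁ = χ² = 1`. Forming connected sums there is an `SO(2)` bundle
> `E'→ Q` with `χ(E') = (1, …, 1) ∈ H²(Q, ℤ)` and `p₁ = -7`. According to the classification of
> `SO(3)` bundles [4] there is an `SO(3)`-bundle `E` with "least negative charge"
> `w₂ = (1, …, 1) ∈ H²(Q, ℤ₂)` and `p₁(E) = -7 + 4 = -3`. The bundle `E` cannot have its
> structure group reduced to `SO(2)` because any potential Euler class reduces to
> `w₂ = (1, …, 1)` and so must satisfy `χ² ≡ -7 (mod 8)`, while `χ² = p₁ = -3`. Thus `E` has no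
> reducible connections. According to the deformation theory for anti-self-dual (ASD)
> connections on `E`, the virtual dimension of the moduli space is
> `dim 𝓜 = -2 p₁(E) - 3(1 - b₁ + b⁺)` … so `dim 𝓜 = -2p₁ - 3(2) = 0`. Since there are no
> reducible connections, `𝓜` will be a manifold for a generic metric on `Q` [10, Proposition
> 3.20], in this case a collection of points. According to Uhlenbeck's fundamental compactness
> results [27], a sequence `[Aᵢ]` … will always have a subsequence which converges—but possibly
> on a less twisted bundle. … For `SO(3)` bundles the "charge" lost at a point comes in positive
> multiples of `-4`. Since it is not possible to have an ASD connection on a bundle with `p₁ > 0`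
> and `p₁(E) = -3`, `𝓜` is compact."

## Main statements (all proved; the only definitions are the two concrete objects)

* `eightfoldBlowupForm` — the lattice `⟨1⟩ ⊕ 8⟨-1⟩` on `ℤ⁹` (Gram matrix `diag(1, -1, …, -1)`),
  the intersection form of `Q = ℂℙ² # 8(-ℂℙ²)` in the basis of the generators of the summands;
  `kotschickClass = (1, …, 1)`, the Euler class `χ(E')` of the connected sum of the canonical
  `SO(2)`-bundles. API: `eightfoldBlowupForm_apply`, symmetric, unimodular, odd, rank `9`,
  `b⁺ = 1`, `b⁻ = 8`, signature `-7` (`sigPos_eightfoldBlowupForm`, `signature_eightfoldBlowupForm`).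
* `eightfoldBlowupForm_kotschickClass_self` — **`χ(E')² = 1 - 8 = -7`** ("`p₁ = -7`"; `p₁ = χ²`
  for an `SO(2)`-bundle).
* `isCharacteristic_eightfoldBlowupForm_iff`, `isCharacteristic_kotschickClass`,
  `isCharacteristic_iff_modEq_kotschickClass` — **the integral classes reducing mod `2` to
  `w₂(E) = (1, …, 1) ∈ H²(Q; ℤ₂)` are exactly the vectors with odd coordinates, i.e. exactly the
  characteristic vectors of the lattice** (so "any potential Euler class" of a reduction is a
  characteristic vector).
* `neg_three_modEq_neg_seven_four`, `le_neg_three_of_modEq_of_neg` — the Dold–Whitney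
  arithmetic: the admissible `p₁` for `w₂ = (1, …, 1)` are `p₁ ≡ w₂² = -7 (mod 4)` [4], `-3` is
  admissible and is the **"least negative charge"** (the largest negative integer `≡ -7 (mod 4)`).
* `apply_self_modEq_neg_seven_of_isCharacteristic`, `apply_self_ne_neg_three_of_isCharacteristic`
  — **`χ² ≡ -7 (mod 8)` for every potential Euler class `χ`, hence `χ² ≠ -3 = p₁(E)`**: "`E`
  cannot have its structure group reduced to `SO(2)` … Thus `E` has no reducible connections."
  The congruence is van der Blij's lemma (`χ² ≡ σ(Q) = -7`), the tree's
  `IsCharacteristic.apply_self_modEq_signature` (Kirby 1989, II Lemma 3.4); a second, direct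
  proof `apply_self_modEq_neg_seven_of_forall_odd` (odd squares are `≡ 1 (mod 8)`) is the one the
  paper has in mind.
* `virtualDim_eq_zero` — **`-2 p₁(E) - 3(1 - b₁ + b⁺) = 6 - 3·2 = 0`** with `p₁(E) = -3`, `b₁ = 0`
  (`Q` simply connected) and `b⁺ = b⁺(⟨1⟩ ⊕ 8⟨-1⟩) = 1` (the tree's `sigPos`).
* `neg_three_add_four_mul_pos` — **compactness arithmetic**: a bubble costs a positive multiple
  of `4` in `p₁`, and `-3 + 4m > 0` for `m ≥ 1`, which no ASD `SO(3)`-connection allows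
  (`p₁ ≤ 0`); with `energy_eq` : `-4π²·p₁(E) = 12π²` (the bound "`∫‖F_A‖² ≤ 12π²`" used on
  p. 225, proof of Point 1).
* Manifolds: `exists_fourManifold_intersectionForm_equivalent_eightfoldBlowupForm` — there is a
  closed smooth simply connected 4-manifold whose intersection form is isometric to
  `⟨1⟩ ⊕ 8⟨-1⟩` (the tree's realisation theorem for diagonal forms, i.e. `ℂℙ² # 8(-ℂℙ²)`,
  Freedman–Quinn 1990 p. 168 / Kirby 1989 II §1); and
  `intersectionForm_apply_self_ne_neg_three` — for EVERY closed `ℤ`-oriented topological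
  4-manifold `M` whose intersection form is isometric to `⟨1⟩ ⊕ 8⟨-1⟩` (`Q`, and every `B`
  homotopy equivalent to `Q`: "the entire bundle discussion goes through for any smooth manifold
  such as `B` which is homotopy equivalent to `Q`", p. 222) no characteristic class has square
  `-3` (`equivalent` transports characteristic vectors, `IsCharacteristic.map`).

## What is NOT here

The topology and analysis these numbers feed, none of which is statable in Mathlib today (cf.
`Literature/Geometry/GaugeTheory/AsdModuliSpace.lean`: `SU(2)`-bundles on closed manifolds,
definitions only): the Dold–Whitney classification of `SO(3)`-bundles over a 4-complex by
`(w₂, p₁)`, `p₁ ≡ 𝔓(w₂) (mod 4)` [4] (so that `E` with `((1,…,1), -3)` EXISTS); the identities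
`p₁(L ⊕ ℝ) = c₁(L)²`, `w₂(L ⊕ ℝ) ≡ c₁(L) (mod 2)` for an `SO(2)`-reduction; the index formula
`dim 𝓜 = -2p₁ - 3(1 - b₁ + b⁺)`; Freed–Uhlenbeck genericity [10, Prop. 3.20]; Uhlenbeck's
compactness theorem [27] and the Chern–Weil inequality `p₁ ≤ 0` for ASD `SO(3)`-connections;
Kotschick's computations `Φ(Q) = 0`, `|Φ(B)| ≥ 4` [16]; Donaldson's orientations [7]. Nothing in
this file is a named fact; `deMichelisFreedman1992_continuum` is untouched.

## References

* S. DeMichelis, M. H. Freedman, *Uncountably many exotic `ℝ⁴`'s in standard 4-space*,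
  J. Differential Geom. 35 (1992) 219–254, §1 (pp. 221–222). [DeMichelisFreedman1992]
* D. Kotschick, *On manifolds homeomorphic to `ℂP² # 8\overline{ℂP}²`*, Invent. Math. 95 (1989)
  591–600 (DeMichelis–Freedman's [16]; cited through §1). [Kotschick1989]
* A. Dold, H. Whitney, *Classification of oriented sphere bundles over a 4-complex*, Ann. of
  Math. 69 (1959) 667–677 (their [4]). [DoldWhitney1959]
* D. Freed, K. Uhlenbeck, *Instantons and Four-Manifolds*, MSRI Publ. 1, Springer 1984 (their
  [10]). [FreedUhlenbeck1984]
* R. C. Kirby, *The Topology of 4-Manifolds*, LNM 1374 (1989), Ch. II §3 Lemma 3.4 (van der Blij)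
  — the lattice lemmas used, all proved in `LatticeFormsCharacteristic.lean`. [Kirby1989]
-/

noncomputable section

open scoped Manifold ContDiff
open Module
open LinearMap (BilinForm)
open LinearMap.BilinForm
open Literature.Topology.FourManifolds
open Literature.AlgebraicTopology.SingularHomology

namespace Literature.Barriers.SmoothPoincare4

/-! ### The lattice `⟨1⟩ ⊕ 8⟨-1⟩ = H²(ℂℙ² # 8(-ℂℙ²); ℤ)` and the class `χ(E') = (1, …, 1)` -/

/-- **The intersection form `⟨1⟩ ⊕ 8⟨-1⟩` of `Q = ℂℙ² # 8(-ℂℙ²)`** on `H²(Q; ℤ) = ℤ⁹`, in the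
basis `α₀, α₁, …, α₈` of the generators of the nine summands (`α₀² = 1`, `αᵢ² = -1` for `i ≥ 1`):
the Gram matrix `diag(1, -1, …, -1)` (DeMichelis–Freedman 1992, §1: "`ℂP² # 8 \overline{ℂP}²`";
Kirby 1989, Ch. II §1: "`# p ℂP² # q(-ℂP²)` has form `p(1) ⊕ q(-1)`"; cf. the tree's
`ninefoldBlowupForm`). [cite: DeMichelisFreedman1992, §1 (p. 221)] -/
def eightfoldBlowupForm : BilinForm ℤ (Fin 9 → ℤ) :=
  Matrix.toBilin' (Matrix.diagonal (Fin.cons 1 fun _ => -1))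

/-- **Kotschick's class `χ(E') = (1, …, 1) ∈ H²(Q; ℤ)`**, the Euler class of the connected sum `E'`
of the canonical `SO(2)`-bundles of the nine summands (DeMichelis–Freedman 1992, §1, p. 221:
"there is an `SO(2)` bundle `E' → Q` with `χ(E') = (1, …, 1) ∈ H²(Q, ℤ)`"); its reduction mod `2`
is `w₂(E) = (1, …, 1) ∈ H²(Q; ℤ₂)`. [cite: DeMichelisFreedman1992, §1 (p. 221)] -/
def kotschickClass : Fin 9 → ℤ := fun _ => 1

/-- The diagonal entries of `⟨1⟩ ⊕ 8⟨-1⟩` are `±1`. [cite: DeMichelisFreedman1992, §1 (p. 221)] -/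
theorem cons_one_neg_one_eq_or (i : Fin 9) :
    (Fin.cons 1 (fun _ => -1) : Fin 9 → ℤ) i = 1 ∨ (Fin.cons 1 (fun _ => -1) : Fin 9 → ℤ) i = -1 := by
  refine Fin.cases ?_ (fun j => ?_) i
  · exact Or.inl rfl
  · exact Or.inr rfl

/-- The diagonal entries of `⟨1⟩ ⊕ 8⟨-1⟩` are odd. [cite: DeMichelisFreedman1992, §1 (p. 221)] -/
theorem odd_cons_one_neg_one (i : Fin 9) : Odd ((Fin.cons 1 (fun _ => -1) : Fin 9 → ℤ) i) := by
  rcases cons_one_neg_one_eq_or i with h | h <;> rw [h] <;> decide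

/-- The diagonal entries of `⟨1⟩ ⊕ 8⟨-1⟩` are non-zero. [cite: DeMichelisFreedman1992, §1 (p. 221)] -/
theorem cons_one_neg_one_ne_zero (i : Fin 9) : (Fin.cons 1 (fun _ => -1) : Fin 9 → ℤ) i ≠ 0 := by
  rcases cons_one_neg_one_eq_or i with h | h <;> rw [h] <;> decide

/-- **Evaluation**: `(x, y) ↦ x₀y₀ − x₁y₁ − ⋯ − x₈y₈`. [cite: DeMichelisFreedman1992, §1 (p. 221)] -/
theorem eightfoldBlowupForm_apply (x y : Fin 9 → ℤ) :
    eightfoldBlowupForm x y = x 0 * y 0 - ∑ i : Fin 8, x i.succ * y i.succ := by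
  rw [eightfoldBlowupForm, toBilin'_diagonal_apply, Fin.sum_univ_succ]
  simp only [Fin.cons_zero, Fin.cons_succ, one_mul, neg_one_mul, mul_neg, Finset.sum_neg_distrib]
  ring

/-- On the standard basis: `αᵢ·αᵢ = ±1` is the `i`-th diagonal entry.
[cite: DeMichelisFreedman1992, §1 (p. 221)] -/
theorem eightfoldBlowupForm_basisFun_self (i : Fin 9) :
    eightfoldBlowupForm (Pi.basisFun ℤ (Fin 9) i) (Pi.basisFun ℤ (Fin 9) i) =
      (Fin.cons 1 (fun _ => -1) : Fin 9 → ℤ) i := by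
  rw [eightfoldBlowupForm, Pi.basisFun_apply, Matrix.toBilin'_single, Matrix.diagonal_apply_eq]

/-- The standard basis `α₀, …, α₈` is orthogonal for `⟨1⟩ ⊕ 8⟨-1⟩`.
[cite: DeMichelisFreedman1992, §1 (p. 221)] -/
theorem isOrthoᵢ_basisFun_eightfoldBlowupForm :
    LinearMap.IsOrthoᵢ eightfoldBlowupForm (Pi.basisFun ℤ (Fin 9)) := by
  intro i j hij
  change eightfoldBlowupForm (Pi.basisFun ℤ (Fin 9) i) (Pi.basisFun ℤ (Fin 9) j) = 0
  rw [eightfoldBlowupForm, Pi.basisFun_apply, Pi.basisFun_apply, Matrix.toBilin'_single,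
    Matrix.diagonal_apply_ne _ hij]

/-- `⟨1⟩ ⊕ 8⟨-1⟩` is symmetric. [cite: DeMichelisFreedman1992, §1 (p. 221)] -/
theorem isSymm_eightfoldBlowupForm : eightfoldBlowupForm.IsSymm :=
  Matrix.isSymm_toBilin'_iff_isSymm.mpr (Matrix.isSymm_diagonal _)

/-- `⟨1⟩ ⊕ 8⟨-1⟩` is unimodular (`det diag(1, -1, …, -1) = 1`; Poincaré duality on the closed
manifold `Q`). [cite: DeMichelisFreedman1992, §1 (p. 221)] -/
theorem isUnimodular_eightfoldBlowupForm : eightfoldBlowupForm.IsUnimodular := by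
  rw [isUnimodular_iff_isUnit_det_holds _ (Pi.basisFun ℤ (Fin 9)), eightfoldBlowupForm,
    LinearMap.BilinForm.toMatrix_basisFun, LinearMap.BilinForm.toMatrix'_toBilin',
    Matrix.det_diagonal]
  have h : ∀ i : Fin 9, IsUnit ((Fin.cons 1 (fun _ => -1) : Fin 9 → ℤ) i) := fun i => by
    rcases cons_one_neg_one_eq_or i with h | h <;> rw [h] <;> norm_num
  exact IsUnit.prod_univ_iff.mpr h

/-- `⟨1⟩ ⊕ 8⟨-1⟩` is odd (of type I: `α₀·α₀ = 1`). [cite: DeMichelisFreedman1992, §1 (p. 221)] -/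
theorem isOdd_eightfoldBlowupForm : eightfoldBlowupForm.IsOdd :=
  (isOdd_toBilin'_diagonal_iff _).mpr ⟨0, odd_cons_one_neg_one 0⟩

/-- `rank H²(Q; ℤ) = b₂(Q) = 9`. [cite: DeMichelisFreedman1992, §1 (p. 221)] -/
theorem finrank_eightfoldBlowupForm : finrank ℤ (Fin 9 → ℤ) = 9 := by
  simp

/-- **`b⁺(Q) = 1` and `b⁻(Q) = 8`**: the maximal positive (negative) definite sublattices of
`⟨1⟩ ⊕ 8⟨-1⟩` have rank `1` (resp. `8`) — the `b⁺` of the dimension formula of §1 (p. 222).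
[cite: DeMichelisFreedman1992, §1 (p. 222)] -/
theorem sigPos_eightfoldBlowupForm :
    sigPos eightfoldBlowupForm.toQuadraticMap = 1 ∧ sigNeg eightfoldBlowupForm.toQuadraticMap = 8 := by
  obtain ⟨hp, hn⟩ := sigPos_eq_card_and_sigNeg_eq_card_of_isOrthoᵢ
    isOrthoᵢ_basisFun_eightfoldBlowupForm
    (fun i => by rw [eightfoldBlowupForm_basisFun_self]; exact cons_one_neg_one_ne_zero i)
  have ep : {i : Fin 9 // 0 < eightfoldBlowupForm (Pi.basisFun ℤ (Fin 9) i) (Pi.basisFun ℤ (Fin 9) i)}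
      ≃ {i : Fin 9 // 0 < (Fin.cons 1 (fun _ => -1) : Fin 9 → ℤ) i} :=
    Equiv.subtypeEquivRight fun i => by rw [eightfoldBlowupForm_basisFun_self]
  have en : {i : Fin 9 // eightfoldBlowupForm (Pi.basisFun ℤ (Fin 9) i) (Pi.basisFun ℤ (Fin 9) i) < 0}
      ≃ {i : Fin 9 // (Fin.cons 1 (fun _ => -1) : Fin 9 → ℤ) i < 0} :=
    Equiv.subtypeEquivRight fun i => by rw [eightfoldBlowupForm_basisFun_self]
  rw [Fintype.card_congr ep] at hp
  rw [Fintype.card_congr en] at hn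
  exact ⟨hp.trans (by decide), hn.trans (by decide)⟩

/-- **`σ(Q) = b⁺ − b⁻ = 1 − 8 = -7`.** [cite: DeMichelisFreedman1992, §1 (p. 221)] -/
theorem signature_eightfoldBlowupForm : eightfoldBlowupForm.signature = -7 := by
  obtain ⟨hp, hn⟩ := sigPos_eightfoldBlowupForm
  rw [LinearMap.BilinForm.signature, hp, hn]
  norm_num

/-! ### `p₁(E') = χ(E')² = -7` and `w₂(E) = (1, …, 1)` -/

/-- **"an `SO(2)` bundle `E' → Q` with `χ(E') = (1, …, 1) ∈ H²(Q, ℤ)` and `p₁ = -7`"**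
(p. 221): `χ(E')·χ(E') = 1 − 8 = -7` (for an `SO(2) = U(1)`-bundle `p₁ = χ²`; for the canonical
bundle of `ℂℙ²`, "`p₁ = χ² = 1`"). [cite: DeMichelisFreedman1992, §1 (p. 221)] -/
theorem eightfoldBlowupForm_kotschickClass_self :
    eightfoldBlowupForm kotschickClass kotschickClass = -7 := by
  rw [eightfoldBlowupForm_apply]
  simp [kotschickClass]

/-- **The characteristic vectors of `⟨1⟩ ⊕ 8⟨-1⟩` are exactly the vectors with odd coordinates**
(the tree's `isCharacteristic_toBilin'_diagonal_iff`, Kirby 1989 II §3).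
[cite: DeMichelisFreedman1992, §1 (p. 221)] [cite: Kirby1989, Ch. II §3, Lemma 3.4 (p. 26)] -/
theorem isCharacteristic_eightfoldBlowupForm_iff (c : Fin 9 → ℤ) :
    eightfoldBlowupForm.IsCharacteristic c ↔ ∀ i, Odd (c i) :=
  isCharacteristic_toBilin'_diagonal_iff odd_cons_one_neg_one c

/-- **`χ(E') = (1, …, 1)` is characteristic** (`χ·x ≡ x·x (mod 2)` for all `x`): its reduction
`w₂(E) = (1, …, 1) ∈ H²(Q; ℤ₂)` is the characteristic element of `H²(Q; ℤ₂)`.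
[cite: DeMichelisFreedman1992, §1 (p. 221)] -/
theorem isCharacteristic_kotschickClass : eightfoldBlowupForm.IsCharacteristic kotschickClass :=
  (isCharacteristic_eightfoldBlowupForm_iff _).mpr fun _ => odd_one

/-- **"any potential Euler class reduces to `w₂ = (1, …, 1)`"** (p. 221): an integral class `c`
reduces mod `2` to `(1, …, 1)` — coordinatewise `cᵢ ≡ 1 (mod 2)` — iff `c` is a characteristic
vector of `⟨1⟩ ⊕ 8⟨-1⟩`. [cite: DeMichelisFreedman1992, §1 (p. 221)] -/
theorem isCharacteristic_iff_modEq_kotschickClass (c : Fin 9 → ℤ) :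
    eightfoldBlowupForm.IsCharacteristic c ↔ ∀ i, c i ≡ kotschickClass i [ZMOD 2] := by
  rw [isCharacteristic_eightfoldBlowupForm_iff]
  refine forall_congr' fun i => ?_
  rw [kotschickClass, Int.ModEq, Int.odd_iff]
  norm_num

/-! ### Dold–Whitney arithmetic: `p₁(E) = -7 + 4 = -3`, the "least negative charge" -/

/-- **`p₁(E) = -3` is admissible for `w₂(E) = (1, …, 1)`**: by the Dold–Whitney classification
[4] the `SO(3)`-bundles over `Q` with `w₂ = (1, …, 1)` have `p₁ ≡ (1, …, 1)² = -7 (mod 4)`, and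
`-3 = -7 + 4` is in this class ("there is an `SO(3)`-bundle `E` with … `w₂ = (1, …, 1) ∈ H²(Q, ℤ₂)`
and `p₁(E) = -7 + 4 = -3`", p. 221). [cite: DeMichelisFreedman1992, §1 (p. 221)]
[cite: DoldWhitney1959] -/
theorem neg_three_modEq_neg_seven_four :
    (-3 : ℤ) ≡ eightfoldBlowupForm kotschickClass kotschickClass [ZMOD 4] := by
  rw [eightfoldBlowupForm_kotschickClass_self]
  decide

/-- **"least negative charge"** (p. 221): among the admissible values `p₁ ≡ -7 (mod 4)`, `-3` is
the largest negative one. [cite: DeMichelisFreedman1992, §1 (p. 221)] -/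
theorem le_neg_three_of_modEq_of_neg {p : ℤ} (hp : p ≡ -7 [ZMOD 4]) (hneg : p < 0) : p ≤ -3 := by
  have h := Int.emod_emod_of_dvd p (dvd_refl (4 : ℤ))
  unfold Int.ModEq at hp
  omega

/-! ### No `SO(2)`-reduction: `χ² ≡ -7 (mod 8)` while `p₁(E) = -3` -/

/-- **"must satisfy `χ² ≡ -7 (mod 8)`"** (p. 221), the paper's computation: a vector with odd
coordinates has `χ·χ = χ₀² − χ₁² − ⋯ − χ₈² ≡ 1 − 8 ≡ -7 (mod 8)`, odd squares being `1 (mod 8)`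
(the tree's `LinearMap.BilinForm.mul_self_modEq_one_eight_of_odd`).
[cite: DeMichelisFreedman1992, §1 (p. 221)] -/
theorem apply_self_modEq_neg_seven_of_forall_odd {c : Fin 9 → ℤ} (hc : ∀ i, Odd (c i)) :
    eightfoldBlowupForm c c ≡ -7 [ZMOD 8] := by
  have h1 : ∀ i, ((c i : ℤ) : ZMod 8) * (c i : ZMod 8) = 1 := fun i => by
    have h := (ZMod.intCast_eq_intCast_iff (c i * c i) 1 8).mpr (mul_self_modEq_one_eight_of_odd (hc i))
    push_cast at h
    exact h
  have key : ((eightfoldBlowupForm c c : ℤ) : ZMod 8) = ((-7 : ℤ) : ZMod 8) := by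
    rw [eightfoldBlowupForm_apply]
    push_cast
    simp only [h1, Finset.sum_const, Finset.card_univ, Fintype.card_fin]
    decide
  exact (ZMod.intCast_eq_intCast_iff _ _ 8).mp key

/-- **`χ² ≡ -7 (mod 8)` for every characteristic vector `χ` of `⟨1⟩ ⊕ 8⟨-1⟩`** — conceptually
van der Blij's lemma `χ·χ ≡ σ (mod 8)` (the tree's `IsCharacteristic.apply_self_modEq_signature`,
Kirby 1989 II Lemma 3.4) with `σ(Q) = -7` (`signature_eightfoldBlowupForm`).
[cite: DeMichelisFreedman1992, §1 (p. 221)] [cite: Kirby1989, Ch. II §3, Lemma 3.4 (p. 26)] -/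
theorem apply_self_modEq_neg_seven_of_isCharacteristic {c : Fin 9 → ℤ}
    (hc : eightfoldBlowupForm.IsCharacteristic c) : eightfoldBlowupForm c c ≡ -7 [ZMOD 8] := by
  rw [← signature_eightfoldBlowupForm]
  exact hc.apply_self_modEq_signature isSymm_eightfoldBlowupForm isUnimodular_eightfoldBlowupForm

/-- **"The bundle `E` cannot have its structure group reduced to `SO(2)` … while
`χ² = p₁ = -3`. Thus `E` has no reducible connections"** (p. 221), the arithmetic: no
characteristic vector of `⟨1⟩ ⊕ 8⟨-1⟩` — no potential Euler class of a reduction `E = L ⊕ ℝ`,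
for which `p₁(E) = χ(L)²` and `χ(L) ≡ w₂(E) = (1, …, 1) (mod 2)` — has square `-3 = p₁(E)`.
[cite: DeMichelisFreedman1992, §1 (p. 221)] -/
theorem apply_self_ne_neg_three_of_isCharacteristic {c : Fin 9 → ℤ}
    (hc : eightfoldBlowupForm.IsCharacteristic c) : eightfoldBlowupForm c c ≠ -3 := by
  intro h
  have h' := apply_self_modEq_neg_seven_of_isCharacteristic hc
  rw [h] at h'
  revert h'
  decide

/-- The same for any class reducing mod `2` to `(1, …, 1)` (the paper's phrasing).
[cite: DeMichelisFreedman1992, §1 (p. 221)] -/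
theorem apply_self_ne_neg_three_of_modEq_kotschickClass {c : Fin 9 → ℤ}
    (hc : ∀ i, c i ≡ kotschickClass i [ZMOD 2]) : eightfoldBlowupForm c c ≠ -3 :=
  apply_self_ne_neg_three_of_isCharacteristic ((isCharacteristic_iff_modEq_kotschickClass c).mpr hc)

/-- **Transport to any isometric lattice** (the form of `Q` in another basis, or the intersection
form of a manifold homotopy equivalent to `Q`): if `L ≅ ⟨1⟩ ⊕ 8⟨-1⟩` then every characteristic
`c ∈ L` has `c·c ≡ -7 (mod 8)` and `c·c ≠ -3` (isometries preserve characteristic vectors,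
`IsCharacteristic.map`, and squares). [cite: DeMichelisFreedman1992, §1 (pp. 221–222)] -/
theorem apply_self_ne_neg_three_of_equivalent {V : Type*} [AddCommGroup V] [Module ℤ V]
    {L : BilinForm ℤ V} (hL : L.Equivalent eightfoldBlowupForm) {c : V}
    (hc : L.IsCharacteristic c) : L c c ≡ -7 [ZMOD 8] ∧ L c c ≠ -3 := by
  obtain ⟨e⟩ := hL
  have hc' : eightfoldBlowupForm.IsCharacteristic (e c) := hc.map e
  have he : eightfoldBlowupForm (e c) (e c) = L c c := e.map_app c c
  refine ⟨?_, ?_⟩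
  · rw [← he]
    exact apply_self_modEq_neg_seven_of_isCharacteristic hc'
  · rw [← he]
    exact apply_self_ne_neg_three_of_isCharacteristic hc'

/-! ### Virtual dimension `0` and compactness -/

/-- **"`dim 𝓜 = -2p₁ - 3(2) = 0`"** (p. 222): the virtual dimension
`-2 p₁(E) - 3(1 - b₁ + b⁺)` of the `SO(3)` ASD moduli space vanishes for `p₁(E) = -3`, `b₁(Q) = 0`
(`Q` is simply connected) and `b⁺(Q) = b⁺(⟨1⟩ ⊕ 8⟨-1⟩) = 1` (`sigPos_eightfoldBlowupForm`) — "in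
this case a collection of points". [cite: DeMichelisFreedman1992, §1 (p. 222)] -/
theorem virtualDim_eq_zero :
    -2 * (-3 : ℤ) - 3 * (1 - (0 : ℕ) + (sigPos eightfoldBlowupForm.toQuadraticMap : ℤ)) = 0 := by
  rw [sigPos_eightfoldBlowupForm.1]
  norm_num

/-- **Compactness arithmetic** (p. 222: "the 'charge' lost at a point comes in positive
multiples of `-4`. Since it is not possible to have an ASD connection on a bundle with `p₁ > 0`
and `p₁(E) = -3`, `𝓜` is compact"): after `m ≥ 1` bubbles the limiting bundle would have
`p₁ = -3 + 4m > 0`. [cite: DeMichelisFreedman1992, §1 (p. 222)] -/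
theorem neg_three_add_four_mul_pos {m : ℕ} (hm : 1 ≤ m) : 0 < (-3 : ℤ) + 4 * m := by
  omega

/-- Conversely the only admissible charge `p₁ ≡ -7 (mod 4)` with `-3 ≤ p₁ ≤ 0` is `-3` itself: no
intermediate bundle can carry the limit either. [cite: DeMichelisFreedman1992, §1 (p. 222)] -/
theorem eq_neg_three_of_modEq_of_le {p : ℤ} (hp : p ≡ -7 [ZMOD 4]) (h₁ : -3 ≤ p) (h₂ : p ≤ 0) :
    p = -3 := by
  unfold Int.ModEq at hp
  omega

/-- **The energy of `E`**: `-4π² p₁(E) = 12π²` — the bound "`∫_M ‖F_A‖² ≤ 12π²`" on the energy of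
a limit of ASD connections on `E` used in the proof of Thm. 2.1, Point 1 (p. 225), by the
Chern–Weil identity `-4π² p₁(E) = ∫ ‖F_A‖²` for an ASD `SO(3)`-connection (p. 224).
[cite: DeMichelisFreedman1992, §2, proof of Point 1 (pp. 224–225)] -/
theorem energy_eq : -4 * Real.pi ^ 2 * (eightfoldBlowupForm kotschickClass kotschickClass + 4) =
    12 * Real.pi ^ 2 := by
  rw [eightfoldBlowupForm_kotschickClass_self]
  push_cast
  ring

/-! ### The manifolds: `Q = ℂℙ² # 8(-ℂℙ²)` and every `M` with `Q_M ≅ ⟨1⟩ ⊕ 8⟨-1⟩` -/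

/-- **`Q = ℂℙ² # 8(-ℂℙ²)` exists as a closed smooth simply connected 4-manifold with
intersection form `⟨1⟩ ⊕ 8⟨-1⟩`**: the tree's realisation theorem for diagonal unimodular forms
(`exists_smooth_intersectionForm_equivalent_toBilin'_diagonal`: `j ℂℙ² # k(-ℂℙ²)`, here `j = 1`,
`k = 8`; Freedman–Quinn 1990, proof of 10.1, p. 168; Kirby 1989, Ch. II §1).
[cite: DeMichelisFreedman1992, §1 (p. 221)] [cite: Kirby1989, Ch. II §1, Examples] -/
theorem exists_fourManifold_intersectionForm_equivalent_eightfoldBlowupForm :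
    ∃ (M : Type) (_ : TopologicalSpace M) (_ : T2Space M) (_ : SecondCountableTopology M)
      (_ : ChartedSpace (EuclideanSpace ℝ (Fin 4)) M) (_ : IsManifold (𝓡 4) ∞ M)
      (_ : CompactSpace M) (_ : SimplyConnectedSpace M) (μ : HomologicalOrientation ℤ M 4),
      (intersectionForm two_add_two_eq_four μ).Equivalent eightfoldBlowupForm :=
  exists_smooth_intersectionForm_equivalent_toBilin'_diagonal 9 _ cons_one_neg_one_eq_or

/-- **No reducible connections on `E → M` for every `M` with the intersection form of `Q`** ("the
entire bundle discussion goes through for any smooth manifold such as `B` which is homotopy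
equivalent to `Q`", p. 222): for a closed `ℤ`-oriented topological 4-manifold `(M, μ)` whose
intersection form on `H²(M; ℤ)/T` is isometric to `⟨1⟩ ⊕ 8⟨-1⟩`, no characteristic class `c` —
no potential Euler class of an `SO(2)`-reduction of the bundle with `w₂ ≡ c`, `p₁ = -3` — has
`c·c = -3`; indeed `c·c ≡ -7 (mod 8)`. [cite: DeMichelisFreedman1992, §1 (pp. 221–222)] -/
theorem intersectionForm_apply_self_ne_neg_three {M : Type*} [TopologicalSpace M]
    (μ : HomologicalOrientation ℤ M 4)
    (hM : (intersectionForm two_add_two_eq_four μ).Equivalent eightfoldBlowupForm)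
    {c : freeCohomology ℤ M 2} (hc : (intersectionForm two_add_two_eq_four μ).IsCharacteristic c) :
    intersectionForm two_add_two_eq_four μ c c ≡ -7 [ZMOD 8] ∧
      intersectionForm two_add_two_eq_four μ c c ≠ -3 :=
  apply_self_ne_neg_three_of_equivalent hM hc

end Literature.Barriers.SmoothPoincare4
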